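import Mathlib.Tactic.Ring
import Mathlib.Tactic.Linarith
import Mathlib.Tactic.Positivity
import Mathlib.Tactic.LinearCombination
import Mathlib.Tactic.FieldSimp
import Mathlib.Data.Real.Basic
import Summits.HodgeConjecture.HodgeConjecture.Theorems.WeilClassTestFormatFourTwoSplit
import HarnessLib

/-!
# Conjecture N in format (4,2), SHARP FORM — part 1/2: the slope lemma and the one-sided case (hodge-weil ladder, GAPS G51b/G51c)

Prover 2, generation 14 (note `run/shared/lean/b2b/hodge-weil/b2b-hweil-pv2-g14/THREE-PHASE-G14.md`). Setting and notation of
`WeilClassTestProductFormula.lean` / `CONJECTURE-N.md` §1 (real (4,2) configurations, centred coordinates; `Q₂`, `Q₄`, purity sums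
`P1, P2, P4`, pairwise ampleness `|u_e − v_f| ≤ A_e − B_f`). pv2-g13 proved `G₀ = Q₂ + Q₄ ≥ 0` (`conjectureN_42`). THIS FILE and its
companion prove the SHARP form `Q₂ + λ·Q₄ ≥ 0` for every `0 ≤ λ` with `λ² ≤ 6λ + 3`, i.e. `λ ≤ 3 + 2√3` — equivalently
`−Q₄/Q₂ ≤ 1/(3 + 2√3) = 2/√3 − 1`, the value pv2-g9 found numerically-exactly for the (4,2) extremal cross configuration
(`CONJECTURE-N.md` §4: `R = 2/√3 − 1`, `3R² + 6R − 1 = 0`). The constant `λ = 4/3` is what the THREE-PHASE REDUCTION of the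
complex-charge conjecture needs (companion files `WeilClassTestThreePhase.lean`, `WeilClassTestFormatFourTwoComplex.lean`).
Content. `Q₄ < 0` only happens when an F-root sees all E-charges on one side (case A of pv2-g13); then on the pure locus
`Q₂ = 2K₀·e₂(m)`, `−Q₄ = 12K₀` with `K₀ = ∏_e b_e > 0` and the INVERSE SLOPES `m_e = a_e/b_e ≥ 1` from that F-root; purity
(`K₀, K₁, K₂` agree from both F-roots) forces the pattern `F₁ E E F₂ E E` and, with the slopes `m'` from `F₂` (two `≤ −1`, two `≥ 1`),
`e₁(m) = e₁(m')`, `e₂(m) = e₂(m')`; the SLOPE LEMMA (`slope_e2_lower`) then gives `S := e₁(m) ≥ 8 + 4√3` (as `S² − 16S + 16 ≥ 0`,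
`S ≥ 4`) and `e₂(m) ≥ 3S − 6 ≥ 6λ`. The sub-cases 'both F-charges below all E-charges', 'F₂ above all', 'odd number of
E-charges below v₂' are impossible. Pure algebra; nothing here is a case of HC, a rung or a door edge (C22); no statement of
Markman's papers is used. New cell result ⇒ Summits/.
-/

set_option linter.dupNamespace false

namespace Summit.HodgeConjecture.HodgeConjecture.WeilClassTestFormatFourTwoLambda

open Summit.HodgeConjecture.HodgeConjecture.WeilClassTestProductFormula
open Summit.HodgeConjecture.HodgeConjecture.WeilClassTestFormatFourTwo

/-- Slopes from an F-root below all E-charges: `m_e ≥ 1` ⇒ `e₂(m) ≥ 3·e₁(m) − 6` (`= Σ_{i<j}(m_i − 1)(m_j − 1) ≥ 0`). -/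
theorem e2_ge_three_e1_sub_six (m₁ m₂ m₃ m₄ : ℝ) (h₁ : 1 ≤ m₁) (h₂ : 1 ≤ m₂) (h₃ : 1 ≤ m₃) (h₄ : 1 ≤ m₄) :
    3 * (m₁ + m₂ + m₃ + m₄) - 6 ≤ m₁ * m₂ + m₁ * m₃ + m₁ * m₄ + m₂ * m₃ + m₂ * m₄ + m₃ * m₄ := by
  have p₁₂ := mul_nonneg (sub_nonneg.2 h₁) (sub_nonneg.2 h₂)
  have p₁₃ := mul_nonneg (sub_nonneg.2 h₁) (sub_nonneg.2 h₃)
  have p₁₄ := mul_nonneg (sub_nonneg.2 h₁) (sub_nonneg.2 h₄)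
  have p₂₃ := mul_nonneg (sub_nonneg.2 h₂) (sub_nonneg.2 h₃)
  have p₂₄ := mul_nonneg (sub_nonneg.2 h₂) (sub_nonneg.2 h₄)
  have p₃₄ := mul_nonneg (sub_nonneg.2 h₃) (sub_nonneg.2 h₄)
  nlinarith [p₁₂, p₁₃, p₁₄, p₂₃, p₂₄, p₃₄]

/-- Slopes from the upper F-root in the pattern `F₁ E E F₂ E E`: `m' = (−p₁, −p₂, q₃, q₄)` with `p₁, p₂ ≥ 1`, `q₃, q₄ ≥ 0`;
with `S = e₁(m')`: `e₂(m') ≤ S²/4 − S − 2` (the defect is `(p₁+p₂−2)(q₃+q₄+2)/2 + (q₃−q₄)²/4 + (p₁−p₂)²/4`). -/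
theorem e2'_le (p₁ p₂ q₃ q₄ : ℝ) (hp₁ : 1 ≤ p₁) (hp₂ : 1 ≤ p₂) (hq₃ : 0 ≤ q₃) (hq₄ : 0 ≤ q₄) :
    p₁ * p₂ - (p₁ + p₂) * (q₃ + q₄) + q₃ * q₄
      ≤ (q₃ + q₄ - p₁ - p₂) ^ 2 / 4 - (q₃ + q₄ - p₁ - p₂) - 2 := by
  have key : (q₃ + q₄ - p₁ - p₂) ^ 2 / 4 - (q₃ + q₄ - p₁ - p₂) - 2 - (p₁ * p₂ - (p₁ + p₂) * (q₃ + q₄) + q₃ * q₄)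
      = (p₁ + p₂ - 2) * (q₃ + q₄ + 2) / 2 + (q₃ - q₄) ^ 2 / 4 + (p₁ - p₂) ^ 2 / 4 := by ring
  have h1 : 0 ≤ (p₁ + p₂ - 2) * (q₃ + q₄ + 2) / 2 := by
    have := mul_nonneg (show 0 ≤ p₁ + p₂ - 2 by linarith) (show 0 ≤ q₃ + q₄ + 2 by linarith)
    linarith
  nlinarith [key, h1, sq_nonneg (q₃ - q₄), sq_nonneg (p₁ - p₂)]

/-- THE SLOPE LEMMA. `m_e ≥ 1` (slopes from `F₁`), `m' = (−p₁, −p₂, q₃, q₄)` (slopes from `F₂`, `p_i, q_i ≥ 1`),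
`e₁(m) = e₁(m')`, `e₂(m) = e₂(m')` ⇒ for every `λ` with `λ² ≤ 6λ + 3` (i.e. `λ ≤ 3 + 2√3`): `e₂(m) ≥ 6λ`.
(From the two previous lemmas `S := e₁(m)` satisfies `S ≥ 4` and `S² − 16S + 16 ≥ 0`, hence `S ≥ 2λ + 2`, and `e₂(m) ≥ 3S − 6`.) -/
theorem slope_lemma (m₁ m₂ m₃ m₄ p₁ p₂ q₃ q₄ l : ℝ) (h₁ : 1 ≤ m₁) (h₂ : 1 ≤ m₂) (h₃ : 1 ≤ m₃) (h₄ : 1 ≤ m₄)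
    (hp₁ : 1 ≤ p₁) (hp₂ : 1 ≤ p₂) (hq₃ : 1 ≤ q₃) (hq₄ : 1 ≤ q₄)
    (he₁ : m₁ + m₂ + m₃ + m₄ = q₃ + q₄ - p₁ - p₂)
    (he₂ : m₁ * m₂ + m₁ * m₃ + m₁ * m₄ + m₂ * m₃ + m₂ * m₄ + m₃ * m₄ = p₁ * p₂ - (p₁ + p₂) * (q₃ + q₄) + q₃ * q₄)
    (hl' : l ^ 2 ≤ 6 * l + 3) :
    6 * l ≤ m₁ * m₂ + m₁ * m₃ + m₁ * m₄ + m₂ * m₃ + m₂ * m₄ + m₃ * m₄ := by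
  set S := m₁ + m₂ + m₃ + m₄ with hS
  have hlow := e2_ge_three_e1_sub_six m₁ m₂ m₃ m₄ h₁ h₂ h₃ h₄
  have hup := e2'_le p₁ p₂ q₃ q₄ hp₁ hp₂ (by linarith) (by linarith)
  rw [← he₂, ← he₁] at hup
  have hS4 : 4 ≤ S := by rw [hS]; linarith
  have hf : 0 ≤ S ^ 2 - 16 * S + 16 := by nlinarith [hlow, hup]
  have h12 : 12 < S := by
    by_contra h
    push Not at h
    have e : (S - 4) * (S - 12) = (S ^ 2 - 16 * S + 16) + 32 := by ring
    have := mul_nonpos_iff.2 (Or.inl ⟨show 0 ≤ S - 4 by linarith, show S - 12 ≤ 0 by linarith⟩)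
    linarith
  have hST : 2 * l + 2 ≤ S := by
    by_cases hc : S - 14 + 2 * l ≤ 0
    · linarith
    · push Not at hc
      have prod : 0 ≤ (S - 2 * l - 2) * (S - 14 + 2 * l) := by
        have e : (S - 2 * l - 2) * (S - 14 + 2 * l) = (S ^ 2 - 16 * S + 16) + (24 * l + 12 - 4 * l ^ 2) := by ring
        rw [e]
        have : 0 ≤ 24 * l + 12 - 4 * l ^ 2 := by linarith
        linarith
      have := le_of_mul_le_mul_right (by linarith [prod] : 0 * (S - 14 + 2 * l) ≤ (S - 2 * l - 2) * (S - 14 + 2 * l)) hc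
      linarith
  linarith

/-- THE ONE-SIDED CASE WITH `K₀ > 0` (pattern `F₁ E E F₂ E E`), denominators cleared. Data: from `F₁`, `0 < b_e ≤ a_e`
(`b_e = u_e − v₁`, `a_e = A_e − B₁`); from `F₂`, `b'₁, b'₂ < 0 < b'₃, b'₄`, `|b'_e| ≤ a'_e`; purity in the form
`K₀ = K₀'`, `K₁ = K₁'`, `K₂ = K₂'` (coefficients of `∏_e(b_e + y·a_e)`). Conclusion: `12λ·K₀ ≤ 2K₂`, i.e. `Q₂ + λQ₄ ≥ 0` there. -/
theorem one_sided_core (a₁ a₂ a₃ a₄ b₁ b₂ b₃ b₄ a₁' a₂' a₃' a₄' b₁' b₂' b₃' b₄' l : ℝ)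
    (hb₁ : 0 < b₁) (hb₂ : 0 < b₂) (hb₃ : 0 < b₃) (hb₄ : 0 < b₄)
    (ha₁ : b₁ ≤ a₁) (ha₂ : b₂ ≤ a₂) (ha₃ : b₃ ≤ a₃) (ha₄ : b₄ ≤ a₄)
    (hb₁' : b₁' < 0) (hb₂' : b₂' < 0) (hb₃' : 0 < b₃') (hb₄' : 0 < b₄')
    (ha₁' : -b₁' ≤ a₁') (ha₂' : -b₂' ≤ a₂') (ha₃' : b₃' ≤ a₃') (ha₄' : b₄' ≤ a₄')
    (hK0 : b₁ * b₂ * b₃ * b₄ = b₁' * b₂' * b₃' * b₄')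
    (hK1 : a₁ * b₂ * b₃ * b₄ + a₂ * b₁ * b₃ * b₄ + a₃ * b₁ * b₂ * b₄ + a₄ * b₁ * b₂ * b₃
      = a₁' * b₂' * b₃' * b₄' + a₂' * b₁' * b₃' * b₄' + a₃' * b₁' * b₂' * b₄' + a₄' * b₁' * b₂' * b₃')
    (hK2 : a₁ * a₂ * b₃ * b₄ + a₁ * a₃ * b₂ * b₄ + a₁ * a₄ * b₂ * b₃ + a₂ * a₃ * b₁ * b₄ + a₂ * a₄ * b₁ * b₃ + a₃ * a₄ * b₁ * b₂
      = a₁' * a₂' * b₃' * b₄' + a₁' * a₃' * b₂' * b₄' + a₁' * a₄' * b₂' * b₃' + a₂' * a₃' * b₁' * b₄' + a₂' * a₄' * b₁' * b₃' + a₃' * a₄' * b₁' * b₂')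
    (hl' : l ^ 2 ≤ 6 * l + 3) :
    12 * l * (b₁ * b₂ * b₃ * b₄) ≤ 2 * (a₁ * a₂ * b₃ * b₄ + a₁ * a₃ * b₂ * b₄ + a₁ * a₄ * b₂ * b₃ + a₂ * a₃ * b₁ * b₄ + a₂ * a₄ * b₁ * b₃ + a₃ * a₄ * b₁ * b₂) := by
  obtain ⟨m₁, hm₁, rfl⟩ : ∃ m, 1 ≤ m ∧ a₁ = m * b₁ := ⟨a₁ / b₁, by rwa [le_div_iff₀ hb₁, one_mul], by field_simp⟩
  obtain ⟨m₂, hm₂, rfl⟩ : ∃ m, 1 ≤ m ∧ a₂ = m * b₂ := ⟨a₂ / b₂, by rwa [le_div_iff₀ hb₂, one_mul], by field_simp⟩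
  obtain ⟨m₃, hm₃, rfl⟩ : ∃ m, 1 ≤ m ∧ a₃ = m * b₃ := ⟨a₃ / b₃, by rwa [le_div_iff₀ hb₃, one_mul], by field_simp⟩
  obtain ⟨m₄, hm₄, rfl⟩ : ∃ m, 1 ≤ m ∧ a₄ = m * b₄ := ⟨a₄ / b₄, by rwa [le_div_iff₀ hb₄, one_mul], by field_simp⟩
  have nb₁ : 0 < -b₁' := by linarith
  have nb₂ : 0 < -b₂' := by linarith
  have ne₁ : b₁' ≠ 0 := hb₁'.ne
  have ne₂ : b₂' ≠ 0 := hb₂'.ne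
  obtain ⟨p₁, hp₁, rfl⟩ : ∃ p, 1 ≤ p ∧ a₁' = p * (-b₁') :=
    ⟨a₁' / (-b₁'), by rwa [le_div_iff₀ nb₁, one_mul], by field_simp⟩
  obtain ⟨p₂, hp₂, rfl⟩ : ∃ p, 1 ≤ p ∧ a₂' = p * (-b₂') :=
    ⟨a₂' / (-b₂'), by rwa [le_div_iff₀ nb₂, one_mul], by field_simp⟩
  obtain ⟨q₃, hq₃, rfl⟩ : ∃ q, 1 ≤ q ∧ a₃' = q * b₃' := ⟨a₃' / b₃', by rwa [le_div_iff₀ hb₃', one_mul], by field_simp⟩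
  obtain ⟨q₄, hq₄, rfl⟩ : ∃ q, 1 ≤ q ∧ a₄' = q * b₄' := ⟨a₄' / b₄', by rwa [le_div_iff₀ hb₄', one_mul], by field_simp⟩
  have hKpos : 0 < b₁ * b₂ * b₃ * b₄ := by positivity
  have e1 : (m₁ + m₂ + m₃ + m₄) * (b₁ * b₂ * b₃ * b₄) = (q₃ + q₄ - p₁ - p₂) * (b₁ * b₂ * b₃ * b₄) := by
    linear_combination hK1 - (q₃ + q₄ - p₁ - p₂) * hK0
  have e2 : (m₁ * m₂ + m₁ * m₃ + m₁ * m₄ + m₂ * m₃ + m₂ * m₄ + m₃ * m₄) * (b₁ * b₂ * b₃ * b₄)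
      = (p₁ * p₂ - (p₁ + p₂) * (q₃ + q₄) + q₃ * q₄) * (b₁ * b₂ * b₃ * b₄) := by
    linear_combination hK2 - (p₁ * p₂ - (p₁ + p₂) * (q₃ + q₄) + q₃ * q₄) * hK0
  have he₁ := mul_right_cancel₀ hKpos.ne' e1
  have he₂ := mul_right_cancel₀ hKpos.ne' e2
  have main := slope_lemma m₁ m₂ m₃ m₄ p₁ p₂ q₃ q₄ l hm₁ hm₂ hm₃ hm₄ hp₁ hp₂ hq₃ hq₄ he₁ he₂ hl'
  have t := mul_le_mul_of_nonneg_right main hKpos.le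
  linarith [t]

/-- Bookkeeping: for positive `b_e` and `0 < q`, `∏(b_e − q) < ∏ b_e` when all `b_e − q > 0`. -/
theorem prod_shift_lt (b₁ b₂ b₃ b₄ q : ℝ) (hq : 0 < q)
    (h₁ : 0 < b₁ - q) (h₂ : 0 < b₂ - q) (h₃ : 0 < b₃ - q) (h₄ : 0 < b₄ - q) :
    (b₁ - q) * (b₂ - q) * (b₃ - q) * (b₄ - q) < b₁ * b₂ * b₃ * b₄ := by
  have s1 : (b₁ - q) * (b₂ - q) * (b₃ - q) * (b₄ - q) < b₁ * (b₂ - q) * (b₃ - q) * (b₄ - q) := by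
    have : 0 < (b₂ - q) * (b₃ - q) * (b₄ - q) := mul_pos (mul_pos h₂ h₃) h₄
    have e : b₁ * (b₂ - q) * (b₃ - q) * (b₄ - q) - (b₁ - q) * (b₂ - q) * (b₃ - q) * (b₄ - q)
        = q * ((b₂ - q) * (b₃ - q) * (b₄ - q)) := by ring
    have := mul_pos hq this
    linarith
  have s2 : b₁ * (b₂ - q) * (b₃ - q) * (b₄ - q) ≤ b₁ * b₂ * b₃ * b₄ := by
    have hb₁ : 0 ≤ b₁ := by linarith
    have t2 : (b₂ - q) ≤ b₂ := by linarith
    have t3 : (b₃ - q) ≤ b₃ := by linarith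
    have t4 : (b₄ - q) ≤ b₄ := by linarith
    have := mul_le_mul (mul_le_mul t2 t3 h₃.le (by linarith)) t4 h₄.le (mul_nonneg (by linarith) (by linarith))
    calc b₁ * (b₂ - q) * (b₃ - q) * (b₄ - q) = b₁ * ((b₂ - q) * (b₃ - q) * (b₄ - q)) := by ring
      _ ≤ b₁ * (b₂ * b₃ * b₄) := mul_le_mul_of_nonneg_left this hb₁
      _ = b₁ * b₂ * b₃ * b₄ := by ring
  exact lt_of_lt_of_le s1 s2

/-- IMPOSSIBLE SUB-CASE 'both F-charges strictly below all E-charges' (centred, P4): if `v₁ ≤ v₂ < u_e` for all `e`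
then `K₀(F₁) = K₀(F₂)` (purity) forces `v₁ = v₂`, and then `P4 = 3·e₃(u − v₁) > 0` — contradiction. -/
theorem both_below_impossible (u₁ u₂ u₃ u₄ v₁ v₂ : ℝ) (hC : u₁ + u₂ + u₃ + u₄ = v₁ + v₂)
    (hP4 : (u₁ ^ 3 + u₂ ^ 3 + u₃ ^ 3 + u₄ ^ 3) - (v₁ ^ 3 + v₂ ^ 3) = 0)
    (ov : v₁ ≤ v₂) (h₁ : v₂ < u₁) (h₂ : v₂ < u₂) (h₃ : v₂ < u₃) (h₄ : v₂ < u₄) : False := by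
  have hK := K0_F1_sub_K0_F2 u₁ u₂ u₃ u₄ v₁ v₂ hC
  rw [hP4, mul_zero] at hK
  rcases ov.eq_or_lt with heq | hlt
  · subst heq
    -- double F-charge: P4 = 3·e₃(b) + (…)·(Σu − 2v₁) with b_e = u_e − v₁ > 0
    have h3 : 3 * ((u₁ - v₁) * (u₂ - v₁) * (u₃ - v₁) + (u₁ - v₁) * (u₂ - v₁) * (u₄ - v₁)
            + (u₁ - v₁) * (u₃ - v₁) * (u₄ - v₁) + (u₂ - v₁) * (u₃ - v₁) * (u₄ - v₁)) = 0 := by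
      linear_combination hP4 - ((u₁ + u₂ + u₃ + u₄ - (v₁ + v₁)) ^ 2 + 6 * v₁ * (u₁ + u₂ + u₃ + u₄ - (v₁ + v₁))
        + 3 * v₁ ^ 2 - 3 * u₃ * (u₁ + u₂ + u₃ + u₄ - (v₁ + v₁)) - 6 * u₃ * v₁ + 3 * u₃ ^ 2
        - 3 * u₂ * (u₁ + u₂ + u₃ + u₄ - (v₁ + v₁)) - 6 * u₂ * v₁ + 3 * u₂ * u₃ + 3 * u₂ ^ 2
        - 3 * u₁ * (u₁ + u₂ + u₃ + u₄ - (v₁ + v₁)) - 6 * u₁ * v₁ + 3 * u₁ * u₃ + 3 * u₁ * u₂ + 3 * u₁ ^ 2) * hC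
    have : 0 < (u₁ - v₁) * (u₂ - v₁) * (u₃ - v₁) + (u₁ - v₁) * (u₂ - v₁) * (u₄ - v₁)
            + (u₁ - v₁) * (u₃ - v₁) * (u₄ - v₁) + (u₂ - v₁) * (u₃ - v₁) * (u₄ - v₁) := by
      have b₁ : 0 < u₁ - v₁ := by linarith
      have b₂ : 0 < u₂ - v₁ := by linarith
      have b₃ : 0 < u₃ - v₁ := by linarith
      have b₄ : 0 < u₄ - v₁ := by linarith
      have t₁ := mul_pos (mul_pos b₁ b₂) b₃
      have t₂ := mul_pos (mul_pos b₁ b₂) b₄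
      have t₃ := mul_pos (mul_pos b₁ b₃) b₄
      have t₄ := mul_pos (mul_pos b₂ b₃) b₄
      linarith
    linarith
  · have lt := prod_shift_lt (u₁ - v₁) (u₂ - v₁) (u₃ - v₁) (u₄ - v₁) (v₂ - v₁) (by linarith)
      (by linarith) (by linarith) (by linarith) (by linarith)
    have e : (u₁ - v₁ - (v₂ - v₁)) * (u₂ - v₁ - (v₂ - v₁)) * (u₃ - v₁ - (v₂ - v₁)) * (u₄ - v₁ - (v₂ - v₁))
        = (u₁ - v₂) * (u₂ - v₂) * (u₃ - v₂) * (u₄ - v₂) := by ring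
    rw [e] at lt
    linarith

/-- IMPOSSIBLE SUB-CASE 'F₁ strictly below and F₂ strictly above all E-charges' (centred, P2, P4, ampleness): `K₁(F₁) > 0 > K₁(F₂)`
contradicts `K₁(F₁) = K₁(F₂)`. -/
theorem below_above_impossible (A₁ A₂ A₃ A₄ B₁ B₂ u₁ u₂ u₃ u₄ v₁ v₂ : ℝ)
    (hA : A₁ + A₂ + A₃ + A₄ = B₁ + B₂) (hC : u₁ + u₂ + u₃ + u₄ = v₁ + v₂)
    (hP2 : (A₁ * u₁ ^ 2 + A₂ * u₂ ^ 2 + A₃ * u₃ ^ 2 + A₄ * u₄ ^ 2) - (B₁ * v₁ ^ 2 + B₂ * v₂ ^ 2) = 0)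
    (hP4 : (u₁ ^ 3 + u₂ ^ 3 + u₃ ^ 3 + u₄ ^ 3) - (v₁ ^ 3 + v₂ ^ 3) = 0)
    (m₁₁ : |u₁ - v₁| ≤ A₁ - B₁) (m₂₁ : |u₂ - v₁| ≤ A₂ - B₁) (m₃₁ : |u₃ - v₁| ≤ A₃ - B₁) (m₄₁ : |u₄ - v₁| ≤ A₄ - B₁)
    (m₁₂ : |u₁ - v₂| ≤ A₁ - B₂) (m₂₂ : |u₂ - v₂| ≤ A₂ - B₂) (m₃₂ : |u₃ - v₂| ≤ A₃ - B₂) (m₄₂ : |u₄ - v₂| ≤ A₄ - B₂)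
    (hb₁ : v₁ < u₁) (hb₂ : v₁ < u₂) (hb₃ : v₁ < u₃) (hb₄ : v₁ < u₄)
    (hc₁ : u₁ < v₂) (hc₂ : u₂ < v₂) (hc₃ : u₃ < v₂) (hc₄ : u₄ < v₂) : False := by
  have hK1 := K1_F1_sub_K1_F2 A₁ A₂ A₃ A₄ B₁ B₂ u₁ u₂ u₃ u₄ v₁ v₂ hA hC
  rw [hP2, hP4, mul_zero, mul_zero, add_zero] at hK1
  have ha₁ : 0 < A₁ - B₁ := lt_of_lt_of_le (by linarith) (le_trans (le_abs_self _) m₁₁)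
  have ha₂ : 0 < A₂ - B₁ := lt_of_lt_of_le (by linarith) (le_trans (le_abs_self _) m₂₁)
  have ha₃ : 0 < A₃ - B₁ := lt_of_lt_of_le (by linarith) (le_trans (le_abs_self _) m₃₁)
  have ha₄ : 0 < A₄ - B₁ := lt_of_lt_of_le (by linarith) (le_trans (le_abs_self _) m₄₁)
  have ha₁' : 0 < A₁ - B₂ := lt_of_lt_of_le (by linarith) (le_trans (neg_le_abs _) m₁₂)
  have ha₂' : 0 < A₂ - B₂ := lt_of_lt_of_le (by linarith) (le_trans (neg_le_abs _) m₂₂)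
  have ha₃' : 0 < A₃ - B₂ := lt_of_lt_of_le (by linarith) (le_trans (neg_le_abs _) m₃₂)
  have ha₄' : 0 < A₄ - B₂ := lt_of_lt_of_le (by linarith) (le_trans (neg_le_abs _) m₄₂)
  have b₁ : 0 < u₁ - v₁ := by linarith
  have b₂ : 0 < u₂ - v₁ := by linarith
  have b₃ : 0 < u₃ - v₁ := by linarith
  have b₄ : 0 < u₄ - v₁ := by linarith
  have c₁ : 0 < v₂ - u₁ := by linarith
  have c₂ : 0 < v₂ - u₂ := by linarith
  have c₃ : 0 < v₂ - u₃ := by linarith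
  have c₄ : 0 < v₂ - u₄ := by linarith
  have pos : 0 < (A₁ - B₁) * (u₂ - v₁) * (u₃ - v₁) * (u₄ - v₁) + (A₂ - B₁) * (u₁ - v₁) * (u₃ - v₁) * (u₄ - v₁) + (A₃ - B₁) * (u₁ - v₁) * (u₂ - v₁) * (u₄ - v₁) + (A₄ - B₁) * (u₁ - v₁) * (u₂ - v₁) * (u₃ - v₁) := by
    have t₁ := mul_pos (mul_pos (mul_pos ha₁ b₂) b₃) b₄
    have t₂ := mul_pos (mul_pos (mul_pos ha₂ b₁) b₃) b₄
    have t₃ := mul_pos (mul_pos (mul_pos ha₃ b₁) b₂) b₄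
    have t₄ := mul_pos (mul_pos (mul_pos ha₄ b₁) b₂) b₃
    linarith
  have neg : (A₁ - B₂) * (u₂ - v₂) * (u₃ - v₂) * (u₄ - v₂) + (A₂ - B₂) * (u₁ - v₂) * (u₃ - v₂) * (u₄ - v₂) + (A₃ - B₂) * (u₁ - v₂) * (u₂ - v₂) * (u₄ - v₂) + (A₄ - B₂) * (u₁ - v₂) * (u₂ - v₂) * (u₃ - v₂)
      = -((A₁ - B₂) * (v₂ - u₂) * (v₂ - u₃) * (v₂ - u₄) + (A₂ - B₂) * (v₂ - u₁) * (v₂ - u₃) * (v₂ - u₄)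
          + (A₃ - B₂) * (v₂ - u₁) * (v₂ - u₂) * (v₂ - u₄) + (A₄ - B₂) * (v₂ - u₁) * (v₂ - u₂) * (v₂ - u₃)) := by ring
  have pos' : 0 < (A₁ - B₂) * (v₂ - u₂) * (v₂ - u₃) * (v₂ - u₄) + (A₂ - B₂) * (v₂ - u₁) * (v₂ - u₃) * (v₂ - u₄)
          + (A₃ - B₂) * (v₂ - u₁) * (v₂ - u₂) * (v₂ - u₄) + (A₄ - B₂) * (v₂ - u₁) * (v₂ - u₂) * (v₂ - u₃) := by
    have t₁ := mul_pos (mul_pos (mul_pos ha₁' c₂) c₃) c₄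
    have t₂ := mul_pos (mul_pos (mul_pos ha₂' c₁) c₃) c₄
    have t₃ := mul_pos (mul_pos (mul_pos ha₃' c₁) c₂) c₄
    have t₄ := mul_pos (mul_pos (mul_pos ha₄' c₁) c₂) c₃
    linarith
  linarith

/-- THE ONE-SIDED CASE, sharp form: E-charges sorted `u₁ ≤ u₂ ≤ u₃ ≤ u₄`, `v₁ ≤ v₂`, and `F₁` weakly below all E-charges
(`v₁ ≤ u₁`). Then `Q₂ + λQ₄ ≥ 0` for every `λ` with `λ² ≤ 6λ + 3` (so for all `λ ≤ 3 + 2√3`, as `Q₄ ≤ 0` here). (`K₀ = 0`: `Q₄ = 0` and `Q₂ = G₀ ≥ 0` by pv2-g13's case A;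
`K₀ > 0`: the position of `v₂` among the E-charges is forced to `u₂ < v₂ < u₃` and `one_sided_core` applies.) -/
theorem one_sided_lambda (A₁ A₂ A₃ A₄ B₁ B₂ u₁ u₂ u₃ u₄ v₁ v₂ : ℝ)
    (hA : A₁ + A₂ + A₃ + A₄ = B₁ + B₂) (hC : u₁ + u₂ + u₃ + u₄ = v₁ + v₂)
    (hP1 : (A₁ ^ 2 * u₁ + A₂ ^ 2 * u₂ + A₃ ^ 2 * u₃ + A₄ ^ 2 * u₄) - (B₁ ^ 2 * v₁ + B₂ ^ 2 * v₂) = 0)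
    (hP2 : (A₁ * u₁ ^ 2 + A₂ * u₂ ^ 2 + A₃ * u₃ ^ 2 + A₄ * u₄ ^ 2) - (B₁ * v₁ ^ 2 + B₂ * v₂ ^ 2) = 0)
    (hP4 : (u₁ ^ 3 + u₂ ^ 3 + u₃ ^ 3 + u₄ ^ 3) - (v₁ ^ 3 + v₂ ^ 3) = 0)
    (m₁₁ : |u₁ - v₁| ≤ A₁ - B₁) (m₂₁ : |u₂ - v₁| ≤ A₂ - B₁) (m₃₁ : |u₃ - v₁| ≤ A₃ - B₁) (m₄₁ : |u₄ - v₁| ≤ A₄ - B₁)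
    (m₁₂ : |u₁ - v₂| ≤ A₁ - B₂) (m₂₂ : |u₂ - v₂| ≤ A₂ - B₂) (m₃₂ : |u₃ - v₂| ≤ A₃ - B₂) (m₄₂ : |u₄ - v₂| ≤ A₄ - B₂)
    (o₁₂ : u₁ ≤ u₂) (o₂₃ : u₂ ≤ u₃) (o₃₄ : u₃ ≤ u₄) (ov : v₁ ≤ v₂) (s₁ : v₁ ≤ u₁)
    (l : ℝ) (hl' : l ^ 2 ≤ 6 * l + 3) :
    0 ≤ (1 / 2) * ((A₁ ^ 2 + A₂ ^ 2 + A₃ ^ 2 + A₄ ^ 2) - (B₁ ^ 2 + B₂ ^ 2)) * ((u₁ ^ 2 + u₂ ^ 2 + u₃ ^ 2 + u₄ ^ 2) - (v₁ ^ 2 + v₂ ^ 2))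
        + ((A₁ * u₁ + A₂ * u₂ + A₃ * u₃ + A₄ * u₄) - (B₁ * v₁ + B₂ * v₂)) ^ 2
        - 3 * ((A₁ ^ 2 * u₁ ^ 2 + A₂ ^ 2 * u₂ ^ 2 + A₃ ^ 2 * u₃ ^ 2 + A₄ ^ 2 * u₄ ^ 2) - (B₁ ^ 2 * v₁ ^ 2 + B₂ ^ 2 * v₂ ^ 2))
      + l * (3 * ((u₁ ^ 4 + u₂ ^ 4 + u₃ ^ 4 + u₄ ^ 4) - (v₁ ^ 4 + v₂ ^ 4)) - (3 / 2) * ((u₁ ^ 2 + u₂ ^ 2 + u₃ ^ 2 + u₄ ^ 2) - (v₁ ^ 2 + v₂ ^ 2)) ^ 2) := by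
  have hQ2 := Q2_eq_F1 A₁ A₂ A₃ A₄ B₁ B₂ u₁ u₂ u₃ u₄ v₁ v₂ hA hC
  have hQ4 := Q4_eq_F1 u₁ u₂ u₃ u₄ v₁ v₂ hC
  rw [hP1, hP2] at hQ2
  rw [hP4] at hQ4
  have hK0 := K0_F1_sub_K0_F2 u₁ u₂ u₃ u₄ v₁ v₂ hC
  rw [hP4, mul_zero] at hK0
  by_cases hz : (u₁ - v₁) * (u₂ - v₁) * (u₃ - v₁) * (u₄ - v₁) = 0
  · have hG := G0_nonneg_of_F1_below A₁ A₂ A₃ A₄ B₁ B₂ u₁ u₂ u₃ u₄ v₁ v₂ hA hC hP1 hP2 hP4 m₁₁ m₂₁ m₃₁ m₄₁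
      s₁ (by linarith) (by linarith) (by linarith)
    have hq4 : 3 * ((u₁ ^ 4 + u₂ ^ 4 + u₃ ^ 4 + u₄ ^ 4) - (v₁ ^ 4 + v₂ ^ 4)) - (3 / 2) * ((u₁ ^ 2 + u₂ ^ 2 + u₃ ^ 2 + u₄ ^ 2) - (v₁ ^ 2 + v₂ ^ 2)) ^ 2 = 0 := by
      rw [hQ4, hz]; ring
    rw [hq4] at hG ⊢
    simpa using hG
  · have hb₁ : 0 < u₁ - v₁ := by
      rcases (sub_nonneg.2 s₁).eq_or_lt with h | h
      · exact absurd (by rw [← h]; ring) hz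
      · exact h
    have hb₂ : 0 < u₂ - v₁ := by linarith
    have hb₃ : 0 < u₃ - v₁ := by linarith
    have hb₄ : 0 < u₄ - v₁ := by linarith
    have hKpos : 0 < (u₁ - v₁) * (u₂ - v₁) * (u₃ - v₁) * (u₄ - v₁) := mul_pos (mul_pos (mul_pos hb₁ hb₂) hb₃) hb₄
    have hK0' : (u₁ - v₂) * (u₂ - v₂) * (u₃ - v₂) * (u₄ - v₂) = (u₁ - v₁) * (u₂ - v₁) * (u₃ - v₁) * (u₄ - v₁) := by linarith
    -- v₂ avoids the E-charges (else K₀(F₂) = 0 ≠ K₀(F₁))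
    have nz : (u₁ - v₂) * (u₂ - v₂) * (u₃ - v₂) * (u₄ - v₂) ≠ 0 := by rw [hK0']; exact ne_of_gt hKpos
    have ne₁ : v₂ ≠ u₁ := fun h => nz (by rw [h]; ring)
    have ne₂ : v₂ ≠ u₂ := fun h => nz (by rw [h]; ring)
    have ne₃ : v₂ ≠ u₃ := fun h => nz (by rw [h]; ring)
    have ne₄ : v₂ ≠ u₄ := fun h => nz (by rw [h]; ring)
    by_cases c1 : v₂ < u₁
    · exact (both_below_impossible u₁ u₂ u₃ u₄ v₁ v₂ hC hP4 ov c1 (by linarith) (by linarith) (by linarith)).elim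
    have d₁ : u₁ < v₂ := lt_of_le_of_ne (not_lt.1 c1) (Ne.symm ne₁)
    by_cases c2 : v₂ < u₂
    · -- exactly one E-charge below v₂: K₀(F₂) < 0
      have : (u₁ - v₂) * (u₂ - v₂) * (u₃ - v₂) * (u₄ - v₂) < 0 := by
        have t : 0 < (u₂ - v₂) * (u₃ - v₂) * (u₄ - v₂) := by
          have := mul_pos (show 0 < u₂ - v₂ by linarith) (show 0 < u₃ - v₂ by linarith)
          exact mul_pos this (by linarith)
        have e : (u₁ - v₂) * (u₂ - v₂) * (u₃ - v₂) * (u₄ - v₂) = (u₁ - v₂) * ((u₂ - v₂) * (u₃ - v₂) * (u₄ - v₂)) := by ring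
        rw [e]; exact mul_neg_of_neg_of_pos (by linarith) t
      linarith
    have d₂ : u₂ < v₂ := lt_of_le_of_ne (not_lt.1 c2) (Ne.symm ne₂)
    by_cases c3 : v₂ < u₃
    · -- THE PATTERN F₁ E E F₂ E E
      have hK1 := K1_F1_sub_K1_F2 A₁ A₂ A₃ A₄ B₁ B₂ u₁ u₂ u₃ u₄ v₁ v₂ hA hC
      rw [hP2, hP4, mul_zero, mul_zero, add_zero] at hK1
      have hK2 := K2_F1_sub_K2_F2 A₁ A₂ A₃ A₄ B₁ B₂ u₁ u₂ u₃ u₄ v₁ v₂ hA hC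
      rw [hP1, hP2, mul_zero, mul_zero, add_zero] at hK2
      have core := one_sided_core (A₁ - B₁) (A₂ - B₁) (A₃ - B₁) (A₄ - B₁) (u₁ - v₁) (u₂ - v₁) (u₃ - v₁) (u₄ - v₁)
        (A₁ - B₂) (A₂ - B₂) (A₃ - B₂) (A₄ - B₂) (u₁ - v₂) (u₂ - v₂) (u₃ - v₂) (u₄ - v₂) l
        hb₁ hb₂ hb₃ hb₄
        (le_trans (le_abs_self _) m₁₁) (le_trans (le_abs_self _) m₂₁) (le_trans (le_abs_self _) m₃₁) (le_trans (le_abs_self _) m₄₁)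
        (by linarith) (by linarith) (by linarith) (by linarith)
        (le_trans (neg_le_abs _) m₁₂) (le_trans (neg_le_abs _) m₂₂) (le_trans (le_abs_self _) m₃₂) (le_trans (le_abs_self _) m₄₂)
        hK0'.symm (by linarith) (by linarith) hl'
      rw [hQ2, hQ4]
      have e : 2 * ((A₁ - B₁) * (A₂ - B₁) * (u₃ - v₁) * (u₄ - v₁)
          + (A₁ - B₁) * (A₃ - B₁) * (u₂ - v₁) * (u₄ - v₁)
          + (A₁ - B₁) * (A₄ - B₁) * (u₂ - v₁) * (u₃ - v₁)
          + (A₂ - B₁) * (A₃ - B₁) * (u₁ - v₁) * (u₄ - v₁)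
          + (A₂ - B₁) * (A₄ - B₁) * (u₁ - v₁) * (u₃ - v₁)
          + (A₃ - B₁) * (A₄ - B₁) * (u₁ - v₁) * (u₂ - v₁))
          - 2 * v₂ * 0 - 2 * B₂ * 0 + l * (-12 * ((u₁ - v₁) * (u₂ - v₁) * (u₃ - v₁) * (u₄ - v₁)) + 4 * v₂ * 0)
          = 2 * ((A₁ - B₁) * (A₂ - B₁) * (u₃ - v₁) * (u₄ - v₁)
          + (A₁ - B₁) * (A₃ - B₁) * (u₂ - v₁) * (u₄ - v₁)
          + (A₁ - B₁) * (A₄ - B₁) * (u₂ - v₁) * (u₃ - v₁)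
          + (A₂ - B₁) * (A₃ - B₁) * (u₁ - v₁) * (u₄ - v₁)
          + (A₂ - B₁) * (A₄ - B₁) * (u₁ - v₁) * (u₃ - v₁)
          + (A₃ - B₁) * (A₄ - B₁) * (u₁ - v₁) * (u₂ - v₁)) - 12 * l * ((u₁ - v₁) * (u₂ - v₁) * (u₃ - v₁) * (u₄ - v₁)) := by ring
      rw [e]
      exact sub_nonneg.2 core
    have d₃ : u₃ < v₂ := lt_of_le_of_ne (not_lt.1 c3) (Ne.symm ne₃)
    by_cases c4 : v₂ < u₄
    · -- exactly three E-charges below v₂: K₀(F₂) < 0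
      have : (u₁ - v₂) * (u₂ - v₂) * (u₃ - v₂) * (u₄ - v₂) < 0 := by
        have t : 0 < (u₁ - v₂) * (u₂ - v₂) * (u₄ - v₂) := by
          have := mul_pos_of_neg_of_neg (show u₁ - v₂ < 0 by linarith) (show u₂ - v₂ < 0 by linarith)
          exact mul_pos this (by linarith)
        have e : (u₁ - v₂) * (u₂ - v₂) * (u₃ - v₂) * (u₄ - v₂) = (u₃ - v₂) * ((u₁ - v₂) * (u₂ - v₂) * (u₄ - v₂)) := by ring
        rw [e]; exact mul_neg_of_neg_of_pos (by linarith) t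
      linarith
    have d₄ : u₄ < v₂ := lt_of_le_of_ne (not_lt.1 c4) (Ne.symm ne₄)
    exact (below_above_impossible A₁ A₂ A₃ A₄ B₁ B₂ u₁ u₂ u₃ u₄ v₁ v₂ hA hC hP2 hP4
      m₁₁ m₂₁ m₃₁ m₄₁ m₁₂ m₂₂ m₃₂ m₄₂ (by linarith) (by linarith) (by linarith) (by linarith) d₁ d₂ d₃ d₄).elim

end Summit.HodgeConjecture.HodgeConjecture.WeilClassTestFormatFourTwoLambda
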